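/-
Origin: expansion seat `planner-pub-hodgecm-pv11-g2-0`, handover #4/#5 v2 2026-08-18T05:09:19Z (`HOME/pub-hodgecm-pv11-g2/lean/Pv11g2/SupplyDictionaryE.lean`, md5 f0822dce, 172 lines);
landed by the gen-6 packager in gate run 22 as `HodgeCM/PerL34/SupplyDictionaryE.lean` (import ^import Pv[0-9]+g[0-9]+\.→import HodgeCM.PerL34. ×1; import ^import Pv[0-9]+\.→import HodgeCM.PerL34. ×1; stripped 3 #print/#check/#eval lines).
-/
import Summits.HodgeConjecture.HodgeCM.PerL34.SupplyDictionary
import Summits.HodgeConjecture.HodgeCM.PerL34.GlobalLatticeDiscrete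

/-!
# Route (E) bridge record, gen 2: the SETUP/D4 block of `SupplyBridge` replaced by archimedean–rational data

Unit `pub-hodgecm-pv11-g2` (DAG node #11, gen 2).  Proposed final place:
`HodgeCM/PerL34/SupplyDictionaryE.lean`; import rewrites on landing:
`Pv11.SupplyDictionary → HodgeCM.PerL34.SupplyDictionary` (gen 1, run 22),
`Pv11g2.GlobalLatticeDiscrete → HodgeCM.PerL34.GlobalLatticeDiscrete` (v2: the v1 fields `instFree`/`instFin`
— '`V(K) ∩ L̂` finitely generated free' — are DERIVED from the archimedean fields `LE, ι, hL, hinj` by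
`GlobalLatticeDiscrete.finite_of_embedding` / `free_of_embedding`, so the record no longer carries them).

Gen 1 (`SupplyDictionary.SupplyBridge T V c k`, `open_supply_of_bridges`) feeds prover 1's open input
`ThetaModel.Open_supply` BY NAME on the §10 (`S^all`) path.  Its SETUP/DICTIONARY block

  `Λ, ℓ, hℓ0, hℓ` (a lattice with a size function), `F, hF, hF0` (`F v = φ_∞(x₀+v)` absolutely summable,
  `F 0 ≠ 0`), `hval : ∀ N, θ_{φ_N}(g₀,u₀) = Σ_v F (N • v)` (D4)

is replaced here (`SupplyBridgeE`) by data one level closer to the objects of PerL: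

* SETUP: `VK` (`V(K)`), `Vf` (`V(𝔸_f)`) as `ℚ`-modules with the diagonal map `ιf`, the adelic lattice `Lhat`
  (`L̂`) with `L := V(K) ∩ L̂` (finite free over `ℤ` — DERIVED, v2); the real space `E = V_∞` with a discrete lattice `LE` and
  the diagonal map `ι : V(K) →+ V_∞` carrying `L` injectively into `LE`; the archimedean test function
  `f = φ_∞ ∈ 𝓢(V_∞, ℂ)` with `f (ι x₀) ≠ 0` at a rational point `x₀`;
* DICTIONARY (D4 at the level of the DEFINITION of the theta kernel): `hker : ∀ N ≥ 1, θ_{φ_N}(g₀,u₀) =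
  Σ'_{ξ ∈ V(K)} 1[ι_f ξ ∈ ι_f x₀ + N • L̂] · f (ι ξ)`; D5 `hcont`, `heq` and the RESIDUAL `form_of_lift` unchanged.

The size function, the absolute summability, the limit `N → ∞`, the lattice-coset identity
`V(K) ∩ (x₀ + N L̂) = x₀ + N L`, the re-indexing of the theta value, the Fourier coefficient on the compact
group and the forcing of the type are then ALL KERNEL (`LatticeTheta`, `RationalCoset`, `SupplyCoset`,
gen-1 `SupplyElementary`): `supply_of_bridgeE`, `open_supply_of_bridgesE`.

No statement of the 2001 programme, of PerL or of QW8 is used or cited.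
-/

set_option autoImplicit false

noncomputable section

open MeasureTheory
open scoped SchwartzMap
open HodgeCM.PerL34.Seesaw HodgeCM.PerL34.SupplyElementary HodgeCM.PerL34.RationalCoset
  HodgeCM.PerL34.SupplyCoset

namespace HodgeCM
namespace PerL34
namespace SupplyDictionaryE

variable {U : Universe} (T : U.ThetaModel)
variable {L : CMField} {ι₁ : L →+* ℂ} (V : HermSpace3 L ι₁) (c : SeesawCtx L) (k : Fin 4)

/-- **The route-(E) bridge record, gen 2** for the theta one-forms of type index `k`; labels of the fields in
the module docstring (SETUP / PRINT `sep` / DICTIONARY `hker`, `hcont`, `heq` / RESIDUAL `form_of_lift`). -/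
structure SupplyBridgeE where
  /-- SETUP (D4′): the theta shell -/
  DS : ThetaSeesawData
  [instA : CommGroup DS.A₁]
  [instT : TopologicalSpace DS.A₁]
  [instTG : IsTopologicalGroup DS.A₁]
  [instC : CompactSpace DS.A₁]
  [instM : MeasurableSpace DS.A₁]
  [instB : BorelSpace DS.A₁]
  /-- SETUP: Haar measure of the compact group `[U(W_j)]` -/
  ν : Measure DS.A₁
  [instF : IsFiniteMeasure ν]
  [instO : ν.IsOpenPosMeasure]
  [instR : ν.IsMulRightInvariant]
  /-- PRINT (Einsiedler–Ward Thm 12.84): characters of `[U(W_j)]` separate points -/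
  sep : CharSeparating DS.A₁
  /-- SETUP: the archimedean torus `U(W_j)(L₀ ⊗ ℝ)` and its map to `[U(W_j)]` -/
  B : Type
  [instBM : Monoid B]
  i : B →* DS.A₁
  /-- SETUP: the weight of `φ_∞` under `U(W_j)(ℝ)` -/
  w : B → ℂ
  /-- SETUP: the rational points `V(K)` -/
  VK : Type
  [instVK : AddCommGroup VK]
  [instVKQ : Module ℚ VK]
  /-- SETUP: the finite-adelic points `V(𝔸_f)` -/
  Vf : Type
  [instVf : AddCommGroup Vf]
  [instVfQ : Module ℚ Vf]
  /-- SETUP: the diagonal map `V(K) → V(𝔸_f)` -/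
  ιf : VK →ₗ[ℚ] Vf
  /-- SETUP: the adelic lattice `L̂ ⊂ V(𝔸_f)` (product of the local lattices) -/
  Lhat : Submodule ℤ Vf
  /-- SETUP: the archimedean completion `V_∞ = V(K) ⊗ ℝ` -/
  E : Type
  [instE : NormedAddCommGroup E]
  [instEℝ : NormedSpace ℝ E]
  [instEfd : FiniteDimensional ℝ E]
  /-- SETUP: a discrete lattice of `V_∞` containing the image of `L` -/
  LE : Submodule ℤ E
  [instLE : DiscreteTopology LE]
  /-- SETUP: the diagonal map `V(K) → V_∞`, injective on `L`, with `ι(L) ⊂ LE` -/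
  ι : VK →+ E
  hL : ∀ v ∈ globalLattice ιf Lhat, ι v ∈ LE
  hinj : Set.InjOn ι (globalLattice ιf Lhat)
  /-- SETUP: the archimedean Schwartz function `φ_∞`, non-zero at the rational point `x₀` -/
  f : 𝓢(E, ℂ)
  x₀ : VK
  hx₀ : f (ι x₀) ≠ 0
  /-- DICTIONARY (D4, definition level): the family `φ_N = φ_∞ ⊗ 1_{x₀ + N𝔏}`, the base point, and the theta
  kernel at the base point as the sum of `φ_N` over the rational points -/
  φN : ℕ → DS.S₁
  g₀ : DS.G
  u₀ : DS.A₁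
  hker : ∀ N : ℕ, N ≠ 0 →
    DS.thetaKernel₁ (φN N) g₀ u₀ = ∑' ξ : VK, (thinCosetK ιf Lhat x₀ N).indicator (fun ξ => f (ι ξ)) ξ
  /-- DICTIONARY (D5): continuity of the theta kernel on `[U(W_j)]` -/
  hcont : ∀ N : ℕ, Continuous fun u => DS.thetaKernel₁ (φN N) g₀ u
  /-- DICTIONARY (D5): `w`-equivariance of the theta kernel under the archimedean torus -/
  heq : ∀ (N : ℕ) (u : DS.A₁) (t : B), DS.thetaKernel₁ (φN N) g₀ (u * i t) = w t * DS.thetaKernel₁ (φN N) g₀ u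
  /-- RESIDUAL ((β) + D1/D5, named; NOT kernel in this package): a nonzero theta lift against a character of the
  forced archimedean type yields a nonzero theta one-form of type index `k` at some level -/
  form_of_lift : ∀ (N : ℕ) (χ : PontryaginDual DS.A₁), 0 < N → (∀ t : B, ((χ (i t) : Circle) : ℂ) * w t = 1) →
    DS.thetaLift₁ ν (fun u => ((χ u : Circle) : ℂ)) (φN N) g₀ ≠ 0 → ∃ Γ : Level V, ∃ ω ∈ T.Theta V c k Γ, ω ≠ 0

attribute [instance] SupplyBridgeE.instA SupplyBridgeE.instT SupplyBridgeE.instTG SupplyBridgeE.instC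
  SupplyBridgeE.instM SupplyBridgeE.instB SupplyBridgeE.instF SupplyBridgeE.instO SupplyBridgeE.instR
  SupplyBridgeE.instBM SupplyBridgeE.instVK SupplyBridgeE.instVKQ SupplyBridgeE.instVf SupplyBridgeE.instVfQ
  SupplyBridgeE.instE SupplyBridgeE.instEℝ SupplyBridgeE.instEfd
  SupplyBridgeE.instLE

variable {T V c k}

/-- **Supply of type index `k` from a gen-2 bridge record**: KERNEL (`supply₁_of_coset_schwartz`) + the one
residual field. -/
theorem supply_of_bridgeE (Br : SupplyBridgeE T V c k) : ∃ Γ : Level V, ∃ ω ∈ T.Theta V c k Γ, ω ≠ 0 := by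
  obtain ⟨N, χ, hN, hne, htype⟩ := GlobalLatticeDiscrete.supply₁_of_coset_schwartz' Br.ιf Br.Lhat Br.LE
    Br.ι Br.hL Br.hinj Br.DS Br.ν Br.sep Br.i Br.w Br.f Br.x₀ Br.hx₀ Br.φN Br.g₀ Br.u₀ Br.hker Br.hcont Br.heq
  exact Br.form_of_lift N χ hN htype hne

variable (T) in
/-- **`Open_supply` BY NAME on the §10 path, gen 2**: a gen-2 bridge record for each of the type indices `0, 1`
in every good context gives prover 1's `ThetaModel.Open_supply`. -/
theorem open_supply_of_bridgesE
    (hB : ∀ {L : CMField} {ι₁ : L →+* ℂ} (V : HermSpace3 L ι₁) (c : SeesawCtx L), T.GoodCtx ι₁ c →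
      Nonempty (SupplyBridgeE T V c 0) ∧ Nonempty (SupplyBridgeE T V c 1)) :
    T.Open_supply := by
  intro L ι₁ V c hc
  obtain ⟨⟨B₀⟩, ⟨B₁⟩⟩ := hB V c hc
  exact ⟨supply_of_bridgeE B₀, supply_of_bridgeE B₁⟩

variable (T) in
/-- Mixed form: either generation of bridge record per type index suffices. -/
theorem open_supply_of_bridges'
    (hB : ∀ {L : CMField} {ι₁ : L →+* ℂ} (V : HermSpace3 L ι₁) (c : SeesawCtx L), T.GoodCtx ι₁ c →
      (Nonempty (SupplyDictionary.SupplyBridge T V c 0) ∨ Nonempty (SupplyBridgeE T V c 0)) ∧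
        (Nonempty (SupplyDictionary.SupplyBridge T V c 1) ∨ Nonempty (SupplyBridgeE T V c 1))) :
    T.Open_supply := by
  intro L ι₁ V c hc
  obtain ⟨h0, h1⟩ := hB V c hc
  refine ⟨?_, ?_⟩
  · rcases h0 with ⟨⟨B₀⟩⟩ | ⟨⟨B₀⟩⟩
    · exact SupplyDictionary.supply_of_bridge B₀
    · exact supply_of_bridgeE B₀
  · rcases h1 with ⟨⟨B₁⟩⟩ | ⟨⟨B₁⟩⟩
    · exact SupplyDictionary.supply_of_bridge B₁
    · exact supply_of_bridgeE B₁

end SupplyDictionaryE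
end PerL34
end HodgeCM

end

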